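import Summits.HubbardSuperconductivity.HubbardSuperconductivity.Theorems.BalabanIRBirComplexStableXYRStubImGradientZero
import Literature.MathematicalPhysics.QuantumFieldTheory.TphiSeminormTaylor
import Literature.Analysis.Calculus.LineRestrictionIteratedDeriv
import HarnessLib

/-!
# Crux `BirComplexStableXYR` (stmt-HubbardSuperconductivity-14845), line `fat-gaussian-defect-calculus`:
# stub G5 `stub_taylorPolyFD_two_genF` — the degree-2 Taylor polynomial of the window weight at `0`

Helper (`--supports`) for the crux
`Summit.HubbardSuperconductivity.HubbardSuperconductivity.Theses.BalabanIR.BirComplexStableXYR`, line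
`fat-gaussian-defect-calculus` (lead skeleton `Cruxes/BirComplexStableXYR/Lines/fat_gaussian_defect_calculus.lean`),
registered stub G5 `stub_taylorPolyFD_two_genF` (chapter 2, wave 9).

**Statement.** For a finite Fourier table `c : Table r` on the window `W r` (vocabulary `Table`, `genF` of
`Theorems.BirComplexStableXY.Negative.WitnessTable`) satisfying (N) `Σ_n c_n = 0`, the coercivity (C)
`c₀ ΣΣ (1 − cos(φ_w − φ_w')) ≤ Re F(φ)` (`c₀ > 0`) and (I3) `Σ_n Im(c_n) (n·v)² = 0`, with `Q(u) = Re(−Σ_n c_n (n·u)²)`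
and `m_w = Σ_n Re(c_n) n_w`, the degree-2 Taylor polynomial at `0` (BBS (7.5.1), landed `taylorPolyFD`) of the
window weight `F = genF c` is `Tay₂ F(u) = i (m·u) + Q(u)/2`.

**Proof.** The diagonal value `Dᵖ F(0)(u, …, u)` is the `p`-th derivative at `s = 0` of the restriction
`s ↦ F(s u)` of `F` to the line through the constants (landed
`Literature.Analysis.Calculus.iteratedDeriv_lineRestriction`; `F` is smooth, a finite sum of exponentials of
linear functionals).  The line derivatives of `F` are landed (`cvxr_hasDerivAt_genF_line`,
`cvxr_hasDerivAt_dgenF_line` of `…RLogConcaveCore`): at `s = 0` they are `Σ_n c_n (n·u) i` and `−Σ_n c_n (n·u)²`,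
and `D⁰F(0) = F(0) = Σ_n c_n = 0` by (N).  Finally `Σ_n c_n (n·u) = Σ_w u_w Σ_n c_n n_w = m·u`, because
`Σ_n Im(c_n) n_w = 0` (landed C7 `FSUnfolding.stub_imGradientZero`, from (N) and (C)), and `−Σ_n c_n (n·u)²` is the
real number `Q(u)` by (I3).  With `0! = 1! = 1`, `2! = 2` this is the claim.  No definitions; sorry-free;
everything else is Mathlib. [folklore]
-/

set_option linter.dupNamespace false -- `Summit.<S>.<S>.Theorems…` repeats the summit name (D-0017 layout)

noncomputable section

namespace Summit.HubbardSuperconductivity.HubbardSuperconductivity.Theorems.FSUnfolding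

open scoped BigOperators
open Literature.MathematicalPhysics.QuantumFieldTheory Literature.Probability.LatticeModels
open Summit.HubbardSuperconductivity.BirComplexStableXYNegative

variable {r : ℕ}

/-- The window weight `genF c` — a finite sum of exponentials of (purely imaginary) linear functionals — is
smooth to every order. [folklore] -/
theorem hsc_tay_genF_contDiff (c : Table r) {N : WithTop ℕ∞} :
    ContDiff ℝ N (fun φ : W r → ℝ => genF c φ) := by
  simp only [genF, Finsupp.sum]
  refine ContDiff.sum fun n _ => contDiff_const.mul (ContDiff.cexp (contDiff_const.mul ?_))
  exact Complex.ofRealCLM.contDiff.comp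
    (ContDiff.sum fun w _ => contDiff_const.mul (contDiff_apply ℝ ℝ w))

/-- **Diagonal derivatives are line derivatives.**  The diagonal value `Dᵖ(genF c)(0)(u, …, u)` of the
`p`-th Fréchet derivative at the constants is the `p`-th derivative at `s = 0` of the restriction
`s ↦ genF c (s u)` to the line through `0` in the direction `u`
(`Literature.Analysis.Calculus.iteratedDeriv_lineRestriction`). [folklore] -/
theorem hsc_tay_iteratedFDeriv_diag_eq (c : Table r) (p : ℕ) (u : W r → ℝ) :
    iteratedFDeriv ℝ p (fun φ : W r → ℝ => genF c φ) 0 (fun _ => u) =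
      iteratedDeriv p (fun s : ℝ => genF c (fun w => (0 : ℝ) + s * u w)) 0 := by
  have h := Literature.Analysis.Calculus.iteratedDeriv_lineRestriction (n := p)
    (hsc_tay_genF_contDiff c) (0 : W r → ℝ) u 0
  rw [zero_smul, add_zero] at h
  rw [← h]
  rfl

/-- The character factor at the origin of the line: `exp(i Σ_w n_w (0 + 0·u_w)) = 1`. [folklore] -/
theorem hsc_tay_cexp_origin (n : Freq r) (u : W r → ℝ) :
    Complex.exp (Complex.I * ((∑ w, (n w : ℝ) * ((0 : ℝ) + 0 * u w) : ℝ) : ℂ)) = 1 := by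
  simp

/-- **First line derivative at the origin**: `∂_s genF c (s u)|₀ = (Σ_n c_n (n·u)) i`
(landed `cvxr_hasDerivAt_genF_line` with `φ = 0`, `t = 0`). [folklore] -/
theorem hsc_tay_lineDeriv_one (c : Table r) (u : W r → ℝ) :
    iteratedDeriv 1 (fun s : ℝ => genF c (fun w => (0 : ℝ) + s * u w)) 0 =
      (∑ n ∈ c.support, c n * ((∑ w, (n w : ℝ) * u w : ℝ) : ℂ)) * Complex.I := by
  rw [iteratedDeriv_one, (cvxr_hasDerivAt_genF_line c (fun _ => (0 : ℝ)) u 0).deriv, Finset.sum_mul]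
  simp only [Finsupp.sum]
  refine Finset.sum_congr rfl fun n _ => ?_
  rw [hsc_tay_cexp_origin, mul_one]

/-- **Second line derivative at the origin**: `∂_s² genF c (s u)|₀ = −Σ_n c_n (n·u)²`
(landed `cvxr_hasDerivAt_genF_line` at every `s`, then `cvxr_hasDerivAt_dgenF_line` at `t = 0`). [folklore] -/
theorem hsc_tay_lineDeriv_two (c : Table r) (u : W r → ℝ) :
    iteratedDeriv 2 (fun s : ℝ => genF c (fun w => (0 : ℝ) + s * u w)) 0 =
      -c.sum (fun n a => a * (((∑ w, (n w : ℝ) * u w) ^ 2 : ℝ) : ℂ)) := by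
  have hderiv : deriv (fun s : ℝ => genF c (fun w => (0 : ℝ) + s * u w)) = fun s : ℝ =>
      c.sum (fun n a => a * ((∑ w, (n w : ℝ) * u w : ℝ) : ℂ) * Complex.I *
        Complex.exp (Complex.I * ((∑ w, (n w : ℝ) * ((0 : ℝ) + s * u w) : ℝ) : ℂ))) := by
    funext s
    exact (cvxr_hasDerivAt_genF_line c (fun _ => (0 : ℝ)) u s).deriv
  rw [show (2 : ℕ) = 1 + 1 from rfl, iteratedDeriv_succ, iteratedDeriv_one, hderiv,
    (cvxr_hasDerivAt_dgenF_line c (fun _ => (0 : ℝ)) u 0).deriv]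
  simp only [Finsupp.sum]
  rw [neg_inj]
  refine Finset.sum_congr rfl fun n _ => ?_
  rw [hsc_tay_cexp_origin, mul_one]

/-- Swapping the window and the frequency sums: `Σ_n a_n (Σ_w n_w u_w) = Σ_w u_w (Σ_n a_n n_w)`. [folklore] -/
theorem hsc_tay_sum_swap (s : Finset (Freq r)) (a : Freq r → ℝ) (u : W r → ℝ) :
    ∑ n ∈ s, a n * ∑ w, (n w : ℝ) * u w = ∑ w, u w * ∑ n ∈ s, a n * (n w : ℝ) := by
  simp_rw [Finset.mul_sum]
  rw [Finset.sum_comm]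
  exact Finset.sum_congr rfl fun w _ => Finset.sum_congr rfl fun n _ => by ring

/-- **Registered stub G5 `stub_taylorPolyFD_two_genF` (verbatim signature): the degree-2 Taylor polynomial of
the window weight at `0` is `i m·u + ½Q(u)`.**  Under (N) (`genF c 0 = Σ c_n = 0`), (C) (so `Σ_n Im(c_n) n = 0`,
landed `stub_imGradientZero`: the linear part `i·Σ_n c_n (n·u)` is `i·m·u`, `m_w = Σ_n Re(c_n) n_w`) and (I3)
(the quadratic part `−½Σ_n c_n (n·u)²` is REAL, equal to `½Q(u)`):
`taylorPolyFD 2 (genF c) u = i·(m·u) + ½Q(u)`, the diagonal derivatives being computed along the line `s ↦ s u`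
(`hsc_tay_iteratedFDeriv_diag_eq`, `hsc_tay_lineDeriv_one`, `hsc_tay_lineDeriv_two`). [folklore] -/
theorem stub_taylorPolyFD_two_genF :
    ∀ (r : ℕ) (c : Table r) (c₀ : ℝ), 0 < c₀ → c.sum (fun _ a => a) = 0 →
      (∀ φ : W r → ℝ, c₀ * ∑ w, ∑ w', (1 - Real.cos (φ w - φ w')) ≤ (genF c φ).re) →
      (∀ v : W r → ℝ, c.sum (fun n a => a.im * (∑ w, (n w : ℝ) * v w) ^ 2) = 0) →
      ∀ (Q : (W r → ℝ) → ℝ),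
      (∀ u : W r → ℝ, Q u = (-c.sum (fun n a => a * (((∑ w, (n w : ℝ) * u w) ^ 2 : ℝ) : ℂ))).re) →
      ∀ (m : W r → ℝ), (∀ w : W r, m w = c.sum (fun n a => a.re * (n w : ℝ))) →
      ∀ u : W r → ℝ,
        taylorPolyFD 2 (fun φ : W r → ℝ => genF c φ) u =
          Complex.I * ((∑ w : W r, m w * u w : ℝ) : ℂ) + (((Q u / 2) : ℝ) : ℂ) := by
  intro r c c₀ hc₀ hN hC hI3 Q hQ m hm u
  have hC7 := stub_imGradientZero r c c₀ hc₀ hN hC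
  -- the three diagonal derivatives at `0`
  have hD0 : iteratedFDeriv ℝ 0 (fun φ : W r → ℝ => genF c φ) 0 (fun _ => u) = 0 := by
    rw [iteratedFDeriv_zero_apply]
    exact imGrad_genF_const_zero c hN
  have hD1 : iteratedFDeriv ℝ 1 (fun φ : W r → ℝ => genF c φ) 0 (fun _ => u) =
      (∑ n ∈ c.support, c n * ((∑ w, (n w : ℝ) * u w : ℝ) : ℂ)) * Complex.I := by
    rw [hsc_tay_iteratedFDeriv_diag_eq, hsc_tay_lineDeriv_one]
  have hD2 : iteratedFDeriv ℝ 2 (fun φ : W r → ℝ => genF c φ) 0 (fun _ => u) =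
      -c.sum (fun n a => a * (((∑ w, (n w : ℝ) * u w) ^ 2 : ℝ) : ℂ)) := by
    rw [hsc_tay_iteratedFDeriv_diag_eq, hsc_tay_lineDeriv_two]
  -- the linear part: `Σ_n c_n (n·u) = m·u` (real part: definition of `m`; imaginary part: C7)
  have hlin : (∑ n ∈ c.support, c n * ((∑ w, (n w : ℝ) * u w : ℝ) : ℂ)) = ((∑ w, m w * u w : ℝ) : ℂ) := by
    apply Complex.ext
    · rw [Complex.re_sum, Complex.ofReal_re]
      simp only [Complex.mul_re, Complex.ofReal_re, Complex.ofReal_im, mul_zero, sub_zero]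
      rw [hsc_tay_sum_swap]
      refine Finset.sum_congr rfl fun w _ => ?_
      rw [hm w]
      simp only [Finsupp.sum]
      ring
    · rw [Complex.im_sum, Complex.ofReal_im]
      simp only [Complex.mul_im, Complex.ofReal_re, Complex.ofReal_im, mul_zero, zero_add]
      rw [hsc_tay_sum_swap]
      refine Finset.sum_eq_zero fun w _ => ?_
      have h := hC7 w
      simp only [Finsupp.sum] at h
      rw [h, mul_zero]
  -- the quadratic part is the real number `Q u` (real part: definition of `Q`; imaginary part: (I3))
  have hquad : -c.sum (fun n a => a * (((∑ w, (n w : ℝ) * u w) ^ 2 : ℝ) : ℂ)) = ((Q u : ℝ) : ℂ) := by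
    apply Complex.ext
    · rw [Complex.ofReal_re, hQ u]
    · have h := hI3 u
      simp only [Finsupp.sum] at h
      rw [Complex.ofReal_im, Complex.neg_im, neg_eq_zero]
      simp only [Finsupp.sum, Complex.im_sum, Complex.mul_im, Complex.ofReal_re, Complex.ofReal_im,
        mul_zero, zero_add]
      exact h
  -- assemble `Σ_{p ≤ 2} (p!)⁻¹ Dᵖ(genF c)(0)(u,…,u)`
  rw [taylorPolyFD_apply, Finset.sum_range_succ, Finset.sum_range_succ, Finset.sum_range_succ,
    Finset.sum_range_zero, zero_add, hD0, hD1, hD2, smul_zero, zero_add, hlin, hquad]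
  simp only [Nat.factorial_one, Nat.factorial_two, Nat.cast_one, Nat.cast_ofNat, inv_one, one_smul,
    Complex.real_smul]
  push_cast
  ring

end Summit.HubbardSuperconductivity.HubbardSuperconductivity.Theorems.FSUnfolding

end
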